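import Summits.RiemannHypothesis.RiemannHypothesis.Theorems.GroundBartaEvenWinsBeyondArchLatticeRippleTChainMoments
import Literature.NumberTheory.LFunctions.WeilTwoPrimeMinorant
import HarnessLib

/-!
# RiemannHypothesis / GroundBarta machinery — PHANTOM CERTIFICATES (1/3): the combined minorant `γ_X`

Helper file (`--supports stmt-RiemannHypothesis-18085`; infrastructure for the Weil-positivity ladder), RH-free, axioms
standard.  Seat rh-explicit-weil-1 (memo `run/shared/lean/pub/rh-explicit/rh-explicit-weil-1/WEIL1-SIZELAW.md`).

The two-prime moment certificate with PHANTOM RIPPLES (`WeilCert23X`, file 2/3) minorises the modified weight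
`w₂₃ + P`, `P = ripplesVal rs` (a cosine sum with frequencies `≥ 2b`, invisible on `C(b)`), by

`wL − γ_X`,  `γ_X(t) := γ₂₃^{(wL₀)}(t) + (wL − wL₀)·1_{|t| < T} − σ_X(t)`,

where `γ₂₃^{(wL₀)} = cellsGamma₂₃ wL₀ cells` is the EXISTING two-prime cell chain at a low level `wL₀` (so that the old pointwise
level test `CellsOK₂₃.level` holds and every landed cell / moment fact is reused verbatim), `σ_X = cellsSigmaX xcells` is the
lattice-ripple minorant chain of `P` on `[0, T]`, and `wL` is the BOOSTED level, justified beyond `T` by a separate level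
hypothesis `∀ |t| ≥ T, wL ≤ w₂₃(t) + P(t)`.  This file proves the properties of `γ_X` the analytic reduction consumes:
`level_sub_gammaX_le` (`wL − γ_X ≤ w₂₃ + P` everywhere), `gammaX_eq_zero` beyond `T`, boundedness / measurability, the sup bound
`abs_gammaX_le`, the moments of all parities `integral_gammaX_pow` and the `|γ_X|`-moment bound `integral_abs_gammaX_mul_pow_le`.
Everything here is proved; no named facts.
-/

set_option linter.dupNamespace false

noncomputable section

open Complex Filter Set MeasureTheory
open scoped Real Topology

namespace Summit.RiemannHypothesis.RiemannHypothesis.Theorems.EvenWinsBeyondArch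

open Literature.NumberTheory.LFunctions

/-! ## The open window indicator and its moments -/

/-- `1_{(−T, T)}(t)` as a real function. [folklore] -/
def indOpen (T : ℚ) (t : ℝ) : ℝ := Set.indicator (Ioo (-(T : ℝ)) T) (fun _ ↦ (1 : ℝ)) t

/-- `indOpen T t = 1` for `|t| < T`. [folklore] -/
theorem indOpen_of_abs_lt {T : ℚ} {t : ℝ} (ht : |t| < T) : indOpen T t = 1 := by
  unfold indOpen
  rw [Set.indicator_of_mem (show t ∈ Ioo (-(T : ℝ)) T from ⟨by linarith [neg_abs_le t], by linarith [le_abs_self t]⟩)]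

/-- `indOpen T t = 0` for `T ≤ |t|`. [folklore] -/
theorem indOpen_of_le_abs {T : ℚ} {t : ℝ} (ht : (T : ℝ) ≤ |t|) : indOpen T t = 0 := by
  unfold indOpen
  refine Set.indicator_of_notMem ?_ _
  rintro ⟨h1, h2⟩
  rcases le_or_gt 0 t with h0 | h0
  · rw [abs_of_nonneg h0] at ht; linarith
  · rw [abs_of_neg h0] at ht; linarith

/-- `0 ≤ indOpen ≤ 1`. [folklore] -/
theorem indOpen_mem {T : ℚ} (t : ℝ) : 0 ≤ indOpen T t ∧ indOpen T t ≤ 1 := by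
  unfold indOpen
  by_cases ht : t ∈ Ioo (-(T : ℝ)) T
  · rw [Set.indicator_of_mem ht]; norm_num
  · rw [Set.indicator_of_notMem ht]; norm_num

/-- `indOpen` is measurable. [folklore] -/
theorem measurable_indOpen (T : ℚ) : Measurable (indOpen T) := by
  unfold indOpen; exact measurable_const.indicator measurableSet_Ioo

/-- `indOpen` is even. [folklore] -/
theorem indOpen_neg (T : ℚ) (t : ℝ) : indOpen T (-t) = indOpen T t := by
  rcases lt_or_ge |t| (T : ℝ) with h | h
  · rw [indOpen_of_abs_lt h, indOpen_of_abs_lt (by rwa [abs_neg])]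
  · rw [indOpen_of_le_abs h, indOpen_of_le_abs (by rwa [abs_neg])]

/-- **Moments of the window indicator.** `t ↦ 1_{(−T,T)}(t) t^q` is integrable and, for `0 ≤ T`,
`∫ 1_{(−T,T)} t^q = (T^{q+1} − (−T)^{q+1})/(q+1)`. [folklore] -/
theorem integral_indOpen_mul_pow {T : ℚ} (hT : 0 ≤ T) (q : ℕ) :
    Integrable (fun t ↦ indOpen T t * t ^ q) ∧
      ∫ t, indOpen T t * t ^ q = ((T : ℝ) ^ (q + 1) - (-(T : ℝ)) ^ (q + 1)) / (q + 1) := by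
  have hT0 : (0 : ℝ) ≤ T := by exact_mod_cast hT
  have hT' : (-(T : ℝ)) ≤ T := by linarith
  have e : (fun t ↦ indOpen T t * t ^ q) = Set.indicator (Ioo (-(T : ℝ)) T) (fun t ↦ t ^ q) := by
    funext t
    unfold indOpen
    by_cases ht : t ∈ Ioo (-(T : ℝ)) T
    · rw [Set.indicator_of_mem ht, Set.indicator_of_mem ht, one_mul]
    · rw [Set.indicator_of_notMem ht, Set.indicator_of_notMem ht, zero_mul]
  rw [e]
  constructor
  · rw [integrable_indicator_iff measurableSet_Ioo]
    exact ((continuous_pow q).continuousOn.integrableOn_Icc (a := -(T : ℝ)) (b := T)).mono_set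
      Ioo_subset_Icc_self
  · rw [integral_indicator measurableSet_Ioo, ← integral_Ioc_eq_integral_Ioo,
      ← intervalIntegral.integral_of_le hT', integral_pow]

/-! ## The combined minorant -/

/-- `γ_X(t) = γ₂₃^{(wL₀)}(t) + (wL − wL₀)·1_{|t|<T} − σ_X(t)`. [folklore] -/
def gammaX (wL₀ wL T : ℚ) (cells : List TPDCell) (xcells : List XTCell) (t : ℝ) : ℝ :=
  cellsGamma₂₃ wL₀ cells t + ((wL : ℝ) - wL₀) * indOpen T t - cellsSigmaX xcells t

section Props

variable {wL₀ wL T : ℚ} {cells : List TPDCell} {xcells : List XTCell} {rs : List (ℤ × ℤ × ℚ)}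

/-- **Minorant property.** If the old chain is valid at level `wL₀`, the lattice-ripple chain is valid for `rs`, and the
boosted level holds beyond `T` (`wL ≤ w₂₃ + P` for `|t| ≥ T`), then `wL − γ_X(t) ≤ w₂₃(t) + P(t)` for every real `t`. [folklore] -/
theorem level_sub_gammaX_le (h23 : CellsOK₂₃ wL₀ T cells) (hX : XCellsOK rs T xcells)
    (hlevel : ∀ t : ℝ, (T : ℝ) ≤ |t| → (wL : ℝ) ≤ weilTwoPrimeWeight t + ripplesVal rs t) (t : ℝ) :
    (wL : ℝ) - gammaX wL₀ wL T cells xcells t ≤ weilTwoPrimeWeight t + ripplesVal rs t := by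
  unfold gammaX
  rcases lt_or_ge |t| (T : ℝ) with ht | ht
  · rw [indOpen_of_abs_lt ht, mul_one]
    have h1 := level_sub_cellsGamma₂₃_le h23 t
    have h2 := cellsSigmaX_le_ripplesVal hX ht
    linarith
  · rw [indOpen_of_le_abs ht, mul_zero, cellsGamma₂₃_eq_zero h23 ht, cellsSigmaX_eq_zero hX ht]
    simpa using hlevel t ht

/-- `γ_X(t) = 0` for `|t| ≥ T`. [folklore] -/
theorem gammaX_eq_zero (h23 : CellsOK₂₃ wL₀ T cells) (hX : XCellsOK rs T xcells) {t : ℝ}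
    (ht : (T : ℝ) ≤ |t|) : gammaX wL₀ wL T cells xcells t = 0 := by
  unfold gammaX
  rw [indOpen_of_le_abs ht, mul_zero, cellsGamma₂₃_eq_zero h23 ht, cellsSigmaX_eq_zero hX ht]
  ring

/-- `γ_X` is measurable. [folklore] -/
theorem measurable_gammaX (wL₀ wL T : ℚ) (cells : List TPDCell) (xcells : List XTCell) :
    Measurable (gammaX wL₀ wL T cells xcells) :=
  ((measurable_cellsGamma₂₃ wL₀ cells).add (measurable_const.mul (measurable_indOpen T))).sub
    (measurable_cellsSigmaX xcells)

/-- `γ_X` is even. [folklore] -/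
theorem gammaX_neg (wL₀ wL T : ℚ) (cells : List TPDCell) (xcells : List XTCell) (t : ℝ) :
    gammaX wL₀ wL T cells xcells (-t) = gammaX wL₀ wL T cells xcells t := by
  unfold gammaX; rw [cellsGamma₂₃_neg, indOpen_neg, cellsSigmaX_neg]

/-- The sup bound constant `max_j bnd_j(wL₀) + |wL − wL₀| + max_j absQ_j`. [folklore] -/
def bndX (wL₀ wL : ℚ) (cells : List TPDCell) (xcells : List XTCell) : ℚ :=
  cellsBndMaxQ₂₃ wL₀ cells + |wL - wL₀| + xCellsBndMaxQ xcells

/-- `0 ≤ bndX`. [folklore] -/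
theorem bndX_nonneg (wL₀ wL : ℚ) (cells : List TPDCell) (xcells : List XTCell) : 0 ≤ bndX wL₀ wL cells xcells := by
  unfold bndX
  have := cellsBndMaxQ₂₃_nonneg wL₀ cells
  have := xCellsBndMaxQ_nonneg xcells
  positivity

/-- **Sup bound.** `|γ_X(t)| ≤ bndX`. [folklore] -/
theorem abs_gammaX_le (h23 : CellsOK₂₃ wL₀ T cells) (hX : XCellsOK rs T xcells) (t : ℝ) :
    |gammaX wL₀ wL T cells xcells t| ≤ (bndX wL₀ wL cells xcells : ℝ) := by
  unfold gammaX bndX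
  push_cast
  have h1 := abs_cellsGamma₂₃_le_bndMax h23 t
  have h2 := abs_cellsSigmaX_le_bndMax hX t
  have h3 : |((wL : ℝ) - wL₀) * indOpen T t| ≤ |((wL : ℝ) - wL₀)| := by
    rw [abs_mul, abs_of_nonneg (indOpen_mem t).1]
    exact mul_le_of_le_one_right (abs_nonneg _) (indOpen_mem t).2
  have h4 : |cellsGamma₂₃ wL₀ cells t + ((wL : ℝ) - wL₀) * indOpen T t - cellsSigmaX xcells t| ≤
      (|cellsGamma₂₃ wL₀ cells t| + |((wL : ℝ) - wL₀) * indOpen T t|) + |cellsSigmaX xcells t| :=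
    (abs_sub _ _).trans (add_le_add (abs_add_le _ _) le_rfl)
  linarith

/-- `γ_X` is bounded. [folklore] -/
theorem exists_abs_gammaX_le (h23 : CellsOK₂₃ wL₀ T cells) (hX : XCellsOK rs T xcells) :
    ∃ B, 0 ≤ B ∧ ∀ t, |gammaX wL₀ wL T cells xcells t| ≤ B :=
  ⟨(bndX wL₀ wL cells xcells : ℝ), by exact_mod_cast bndX_nonneg wL₀ wL cells xcells, abs_gammaX_le h23 hX⟩

/-- The exact even moments of `γ_X`: `cellsMomentQ₂₃ wL₀ q + (wL − wL₀) T^{q+1}/(q+1) − xCellsMomentQ q` (half of `∫ γ_X t^q`). [folklore] -/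
def momentX (wL₀ wL T : ℚ) (cells : List TPDCell) (xcells : List XTCell) (q : ℕ) : ℚ :=
  cellsMomentQ₂₃ wL₀ cells q + (wL - wL₀) * (T ^ (q + 1) / (q + 1)) - xCellsMomentQ xcells q

/-- The `|γ_X|`-moment bound: `cellsAbsMomentQ₂₃ wL₀ q + |wL − wL₀| T^{q+1}/(q+1) + xCellsAbsMomentQ q` (half of the bound). [folklore] -/
def absMomentX (wL₀ wL T : ℚ) (cells : List TPDCell) (xcells : List XTCell) (q : ℕ) : ℚ :=
  cellsAbsMomentQ₂₃ wL₀ cells q + |wL - wL₀| * (T ^ (q + 1) / (q + 1)) + xCellsAbsMomentQ xcells q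

/-- All-parity moments of the old chain `γ₂₃` (the `WeilCert23`-free form of `WeilCert23.integral_gamma_pow`). [folklore] -/
theorem integral_cellsGamma₂₃_pow (h23 : CellsOK₂₃ wL₀ T cells) (q : ℕ) :
    Integrable (fun t ↦ cellsGamma₂₃ wL₀ cells t * t ^ q) ∧
      ∫ t, cellsGamma₂₃ wL₀ cells t * t ^ q = if Even q then 2 * (cellsMomentQ₂₃ wL₀ cells q : ℝ) else 0 := by
  rcases Nat.even_or_odd q with hq | hq
  · rw [if_pos hq]; exact integral_cellsGamma₂₃_mul_pow h23 hq
  · rw [if_neg (Nat.not_even_iff_odd.2 hq)]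
    have h0 := (integral_abs_cellsGamma₂₃_mul_pow_le h23 Even.zero).1
    have h1 := (integral_abs_cellsGamma₂₃_mul_pow_le h23 hq.add_one).1
    simp only [pow_zero, mul_one] at h0
    set γ := cellsGamma₂₃ wL₀ cells with hγ
    have hint : Integrable (fun t ↦ γ t * t ^ q) := by
      refine Integrable.mono' (h0.add h1)
        (((measurable_cellsGamma₂₃ _ _).mul (measurable_id.pow_const q)).aestronglyMeasurable)
        (Eventually.of_forall fun t ↦ ?_)
      rw [Real.norm_eq_abs, abs_mul]
      simp only [Pi.add_apply]
      rw [show |γ t| + |γ t| * t ^ (q + 1) = |γ t| * (1 + t ^ (q + 1)) by ring]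
      refine mul_le_mul_of_nonneg_left ?_ (abs_nonneg _)
      rw [abs_pow]
      rcases le_or_gt |t| 1 with ht | ht
      · have : |t| ^ q ≤ 1 := pow_le_one₀ (abs_nonneg t) ht
        have : 0 ≤ t ^ (q + 1) := by rw [← (hq.add_one).pow_abs]; positivity
        linarith
      · have : |t| ^ q ≤ |t| ^ (q + 1) := pow_le_pow_right₀ ht.le (Nat.le_succ q)
        rw [(hq.add_one).pow_abs] at this
        linarith
    refine ⟨hint, ?_⟩
    have hodd : ∀ t, γ (-t) * (-t) ^ q = -(γ t * t ^ q) := by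
      intro t; rw [hγ, cellsGamma₂₃_neg, hq.neg_pow]; ring
    have h2 := integral_neg_eq_self (fun t ↦ γ t * t ^ q) volume
    simp_rw [hodd] at h2
    rw [integral_neg] at h2
    linarith

/-- **Moments of `γ_X`, all parities.** `t ↦ γ_X(t) t^q` is integrable and
`∫ γ_X t^q = 2·momentX q` for even `q`, `0` for odd `q`. [folklore] -/
theorem integral_gammaX_pow (h23 : CellsOK₂₃ wL₀ T cells) (hX : XCellsOK rs T xcells) (q : ℕ) :
    Integrable (fun t ↦ gammaX wL₀ wL T cells xcells t * t ^ q) ∧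
      ∫ t, gammaX wL₀ wL T cells xcells t * t ^ q =
        if Even q then 2 * (momentX wL₀ wL T cells xcells q : ℝ) else 0 := by
  have hT : 0 ≤ T := hX.T_nonneg
  obtain ⟨i1, v1⟩ := integral_cellsGamma₂₃_pow h23 q (wL₀ := wL₀)
  obtain ⟨i2, v2⟩ := integral_indOpen_mul_pow hT q
  obtain ⟨i3, v3⟩ := integral_cellsSigmaX_pow hX q
  have e : (fun t ↦ gammaX wL₀ wL T cells xcells t * t ^ q) = fun t ↦
      cellsGamma₂₃ wL₀ cells t * t ^ q + ((wL : ℝ) - wL₀) * (indOpen T t * t ^ q) - cellsSigmaX xcells t * t ^ q := by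
    funext t; unfold gammaX; ring
  rw [e]
  have i2' : Integrable (fun t ↦ ((wL : ℝ) - wL₀) * (indOpen T t * t ^ q)) := i2.const_mul _
  have i12 : Integrable (fun t ↦ cellsGamma₂₃ wL₀ cells t * t ^ q + ((wL : ℝ) - wL₀) * (indOpen T t * t ^ q)) :=
    i1.add i2'
  refine ⟨i12.sub i3, ?_⟩
  rw [integral_sub i12 i3, integral_add i1 i2', integral_const_mul, v1, v2, v3]
  rcases Nat.even_or_odd q with hq | hq
  · rw [if_pos hq, if_pos hq, if_pos hq, (hq.add_one).neg_pow]
    unfold momentX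
    push_cast
    ring
  · rw [if_neg (Nat.not_even_iff_odd.2 hq), if_neg (Nat.not_even_iff_odd.2 hq), if_neg (Nat.not_even_iff_odd.2 hq),
      (hq.add_one).neg_pow]
    ring

/-- **`|γ_X|`-moments.** For even `q`, `t ↦ |γ_X(t)| t^q` is integrable and `∫ |γ_X| t^q ≤ 2·absMomentX q`. [folklore] -/
theorem integral_abs_gammaX_mul_pow_le (h23 : CellsOK₂₃ wL₀ T cells) (hX : XCellsOK rs T xcells) {q : ℕ} (hq : Even q) :
    Integrable (fun t ↦ |gammaX wL₀ wL T cells xcells t| * t ^ q) ∧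
      ∫ t, |gammaX wL₀ wL T cells xcells t| * t ^ q ≤ 2 * (absMomentX wL₀ wL T cells xcells q : ℝ) := by
  have hT : 0 ≤ T := hX.T_nonneg
  obtain ⟨hFi, -⟩ := integral_gammaX_pow h23 hX q (wL := wL)
  obtain ⟨j1, w1⟩ := integral_abs_cellsGamma₂₃_mul_pow_le h23 hq
  obtain ⟨j2, w2⟩ := integral_indOpen_mul_pow hT q
  obtain ⟨j3, w3⟩ := integral_abs_cellsSigmaX_mul_pow_le hX hq
  have hev : (fun t ↦ |gammaX wL₀ wL T cells xcells t| * t ^ q) = fun t ↦ |gammaX wL₀ wL T cells xcells t * t ^ q| := by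
    funext t; rw [abs_mul, abs_pow, hq.pow_abs]
  have hint : Integrable (fun t ↦ |gammaX wL₀ wL T cells xcells t| * t ^ q) := by rw [hev]; exact hFi.abs
  refine ⟨hint, ?_⟩
  have j2' : Integrable (fun t ↦ |((wL : ℝ) - wL₀)| * (indOpen T t * t ^ q)) := j2.const_mul _
  have j12 : Integrable (fun t ↦ |cellsGamma₂₃ wL₀ cells t| * t ^ q + |((wL : ℝ) - wL₀)| * (indOpen T t * t ^ q)) :=
    j1.add j2'
  have hGi : Integrable (fun t ↦ |cellsGamma₂₃ wL₀ cells t| * t ^ q + |((wL : ℝ) - wL₀)| * (indOpen T t * t ^ q) +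
      |cellsSigmaX xcells t| * t ^ q) := j12.add j3
  have hle : ∀ t, |gammaX wL₀ wL T cells xcells t| * t ^ q ≤
      |cellsGamma₂₃ wL₀ cells t| * t ^ q + |((wL : ℝ) - wL₀)| * (indOpen T t * t ^ q) + |cellsSigmaX xcells t| * t ^ q := by
    intro t
    have htq : 0 ≤ t ^ q := by rw [← hq.pow_abs]; positivity
    have h3 : |((wL : ℝ) - wL₀) * indOpen T t| = |((wL : ℝ) - wL₀)| * indOpen T t := by
      rw [abs_mul, abs_of_nonneg (indOpen_mem t).1]
    have habs : |gammaX wL₀ wL T cells xcells t| ≤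
        |cellsGamma₂₃ wL₀ cells t| + |((wL : ℝ) - wL₀)| * indOpen T t + |cellsSigmaX xcells t| := by
      unfold gammaX
      rw [← h3]
      exact (abs_sub _ _).trans (add_le_add (abs_add_le _ _) le_rfl)
    have := mul_le_mul_of_nonneg_right habs htq
    linarith
  have hmono := integral_mono hint hGi hle
  refine hmono.trans ?_
  rw [integral_add j12 j3, integral_add j1 j2', integral_const_mul, w2, (hq.add_one).neg_pow]
  unfold absMomentX
  push_cast
  have hTq : ((T : ℝ) ^ (q + 1) - -(T : ℝ) ^ (q + 1)) / (q + 1) = 2 * ((T : ℝ) ^ (q + 1) / (q + 1)) := by ring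
  rw [hTq]
  have habsq : |((wL : ℝ) - wL₀)| = ((|wL - wL₀| : ℚ) : ℝ) := by push_cast; rfl
  rw [habsq]
  nlinarith [w1, w3, abs_nonneg (wL - wL₀), show (0:ℝ) ≤ (T : ℝ) ^ (q + 1) / (q + 1) by
    have : (0:ℝ) ≤ T := by exact_mod_cast hT
    positivity]

/-- `0 ≤ absMomentX q` for even `q`. [folklore] -/
theorem absMomentX_nonneg (h23 : CellsOK₂₃ wL₀ T cells) (hX : XCellsOK rs T xcells) {q : ℕ} (hq : Even q) :
    (0 : ℝ) ≤ (absMomentX wL₀ wL T cells xcells q : ℝ) := by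
  have h := (integral_abs_gammaX_mul_pow_le (wL := wL) h23 hX hq).2
  have h0 : 0 ≤ ∫ t, |gammaX wL₀ wL T cells xcells t| * t ^ q :=
    integral_nonneg fun t ↦ mul_nonneg (abs_nonneg _) (by rw [← hq.pow_abs]; positivity)
  linarith

end Props

end Summit.RiemannHypothesis.RiemannHypothesis.Theorems.EvenWinsBeyondArch

end
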